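import Summits.QuantumAdvantage.QuantumAdvantage.Theses.ExactnessDial
import Summits.QuantumAdvantage.QuantumAdvantage.Theorems.RingSymmetrizationLaw3
import Literature.Computability.MetaComplexity.LowDegreeComposition
import Literature.Computability.MetaComplexity.SmolenskyCorrelationRestrict

/-!
# ScaleDial, part A/3: the loss-SCALE rungs at polylog degree, the pieces, the exact cut of 26533, and the TOP flank
(quasi-polynomial symmetrisation `qFracU3_iff_cov : QFracU3 ↔ CovQFracU3`, `topLift3_iff_cov`) — support for item 26533

Cell decomp-qadv, seat lens-1 («grading / quantitative ladder»), generation 12 — land port of the node «ScaleDial»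
(published under the cell's HOME/decomp-qadv-lens-1/g12/ScaleDial.lean, record NODE-g12.md; RESIDUAL MODE on
ExactnessDial:26533 `MassStep3u := NoPerfectOdd3 → PolyLossOddU3`).  Prop-defs = the node's rungs / pieces / predicates
only.  No `sorry`, no new axioms, no instances, no notation.

Rungs: `QML3` (≥ `2^((log₂ n)^A)` odd losses ∀A), `QFracU3` (loss fraction `2^(−(log₂ n)^B)` ∃B), covariant readings
`CovQFracU3`, `CovPolyLossOddU3`; pieces `MesoLift3 := QML3 → QFracU3` (declared residual), `MesoLiftExact3 :=
NoPerfectOdd3 → QFracU3`, `TopLift3 := QFracU3 → PolyLossOddU3`, `CovTopLift3`; `massStep3u_iff_cut : MassStep3u ↔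
(MesoLiftExact3 ∧ TopLift3)`; necessity `pieces_of_polyLossOddU3`, `pieces_of_ringHardOdd3`; `closes_exact` BY NAME via
`exactnessDial_closes₄`.  Part B re-derives the g10 stitch / g4 fold cores; part C proves absorption
`NoPerfectOdd3 ↔ QML3`, the node equation `MassStep3u ↔ (MesoLift3 ∧ TopLift3)` and `closes`.
-/

set_option linter.dupNamespace false
set_option linter.style.longLine false

noncomputable section

open scoped Classical

namespace Summit.QuantumAdvantage.QuantumAdvantage.Theorems.ScaleDial

open Finset
open Literature.Computability.QuantumComplexity Literature.Computability.QuantumComplexity.RingHLF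
open Literature.Computability.MetaComplexity Literature.Computability.MetaComplexity.Smolensky
open Summit.QuantumAdvantage.AdviceFreeQNC0
open Summit.QuantumAdvantage.QuantumAdvantage.Theorems.RingPeriodFold (cov covStrat covStrat_mem_lowDeg)
open Summit.QuantumAdvantage.QuantumAdvantage.Theses.ExactnessDial (NoPerfectOdd3 PolyLossOddU3 MassStep3u OddToAll3
  DPLift3 MultiRingBridge3 NoPerfectConst3)


/-! ### The rungs of the loss ladder at polylog degree (odd class of the `n`-cycle, `𝔽₃`) -/

/-- the odd-class LOSS set of a strategy. -/
def losers (n : ℕ) (P : Fin n → CubeFn (ZMod 3) n) : Finset (Fin n → Bool) :=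
  univ.filter fun x : Fin n → Bool => OddZeros x ∧ ¬ RingHLF.Rel x (fun i => decide (P i x = 1))

/-- the odd-class WIN set of a strategy. -/
def winners (n : ℕ) (P : Fin n → CubeFn (ZMod 3) n) : Finset (Fin n → Bool) :=
  univ.filter fun x : Fin n → Bool => OddZeros x ∧ RingHLF.Rel x (fun i => decide (P i x = 1))

/-- **QML3 — quasi-polynomially MANY losses**: for every `A`, every polylog-degree strategy loses at least
`2^((log₂ n)^A)` odd patterns, eventually.  (The bottom of the loss ladder above exactness.) -/
def QML3 : Prop :=
  ∀ A c : ℕ, ∃ n₀ : ℕ, ∀ n ≥ n₀, ∀ P : Fin n → CubeFn (ZMod 3) n,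
    (∀ i, P i ∈ lowDeg (ZMod 3) n ((Nat.log 2 n) ^ c)) → 2 ^ ((Nat.log 2 n) ^ A) ≤ (losers n P).card

/-- **QFracU3 — quasi-polynomial loss FRACTION, one exponent**: some `B` such that every polylog-degree strategy
wins at most `(1 − 2^{−(log₂ n)^B})·2^(n−1)` odd patterns, eventually.  (26531 with `n^C` replaced by
`2^((log₂ n)^B)`: the COVARIANCE THRESHOLD of the loss ladder — see `qFracU3_iff_cov`.) -/
def QFracU3 : Prop :=
  ∃ B : ℕ, ∀ c : ℕ, ∃ n₀ : ℕ, ∀ n ≥ n₀, ∀ P : Fin n → CubeFn (ZMod 3) n,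
    (∀ i, P i ∈ lowDeg (ZMod 3) n ((Nat.log 2 n) ^ c)) →
      ((winners n P).card : ℝ) ≤ (1 - 1 / (2 : ℝ) ^ ((Nat.log 2 n) ^ B)) * (2 : ℝ) ^ (n - 1)

/-- the covariant reading of `QFracU3`: ONE polynomial `Q`, strategy `x ↦ (b ↦ [Q(rot_b x) = 1])`. -/
def CovQFracU3 : Prop :=
  ∃ B : ℕ, ∀ c : ℕ, ∃ n₀ : ℕ, ∀ n ≥ n₀, ∀ Q : CubeFn (ZMod 3) n,
    Q ∈ lowDeg (ZMod 3) n ((Nat.log 2 n) ^ c) →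
      ((univ.filter fun x : Fin n → Bool => OddZeros x ∧ RingHLF.Rel x (cov Q x)).card : ℝ) ≤
        (1 - 1 / (2 : ℝ) ^ ((Nat.log 2 n) ^ B)) * (2 : ℝ) ^ (n - 1)

/-- the covariant reading of the junction 26531 (`RingSymmetrizationLaw3.polyLossOddU3_iff_cov`). -/
def CovPolyLossOddU3 : Prop :=
  ∃ C : ℕ, ∀ c : ℕ, ∃ n₀ : ℕ, ∀ n ≥ n₀, ∀ Q : CubeFn (ZMod 3) n,
    Q ∈ lowDeg (ZMod 3) n ((Nat.log 2 n) ^ c) →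
      ((univ.filter fun x : Fin n → Bool => OddZeros x ∧ RingHLF.Rel x (cov Q x)).card : ℝ) ≤
        (1 - 1 / (n : ℝ) ^ C) * (2 : ℝ) ^ (n - 1)

/-! ### The pieces -/

/-- **MesoLift3 — THE MESOSCOPIC LIFT** [M · declared RESIDUAL · T-implied (`pieces_of_polyLossOddU3`,
`(massStep3u_iff_pieces).1`) · UNDECIDED (test: `≡ MassStep3u` iff `TopLift3`; probe `MesoLift3 → MassStep3u` fails) ·
leaf IDEA-NEEDED]: quasi-polynomially many losses ⟹ a quasi-polynomial loss FRACTION.  Below its conclusion no covariant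
normal form is available (F2 starts at `2^(−polylog)`); at its hypothesis absorption is spent (F1 ends at `2^polylog`). -/
def MesoLift3 : Prop := QML3 → QFracU3

/-- the same lift read from exactness (kernel-equivalent to `MesoLift3` by the absorption law `noPerfectOdd3_iff_qml3`). -/
def MesoLiftExact3 : Prop := NoPerfectOdd3 → QFracU3

/-- **TopLift3 — THE DENSITY UPGRADE AT THE COVARIANCE SCALE** [W · T-implied (`pieces_of_polyLossOddU3`) · UNDECIDED
(test: `≡ MassStep3u` iff `MesoLift3`; probes `TopLift3 → MassStep3u`, `CovTopLift3 → PolyLossOddU3` fail) · leaf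
INSTRUMENTABLE/ATTACKABLE via its ONE-POLYNOMIAL form `CovTopLift3` (`topLift3_iff_cov`)]: quasi-polynomial loss
fraction ⟹ inverse-polynomial loss fraction (the junction 26531) — an amplification statement for one rotation-covariant
polylog-degree polynomial. -/
def TopLift3 : Prop := QFracU3 → PolyLossOddU3

/-- the one-polynomial (rotation-covariant) form of `TopLift3`. -/
def CovTopLift3 : Prop := CovQFracU3 → CovPolyLossOddU3

/-! ### Monotonicity along the ladder -/

/-- ScaleDialAA helper `losers_card_add_winners_card` (decomp-qadv land package; see the module docstring). -/
theorem losers_card_add_winners_card (n : ℕ) (P : Fin n → CubeFn (ZMod 3) n) :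
    (winners n P).card + (losers n P).card = (univ.filter fun x : Fin n → Bool => OddZeros x).card := by
  have h := Finset.card_filter_add_card_filter_not (s := univ.filter fun x : Fin n → Bool => OddZeros x)
    (fun x => RingHLF.Rel x (fun i => decide (P i x = 1)))
  rw [Finset.filter_filter, Finset.filter_filter] at h
  exact h

/-- parity of the zero count flips with bit `0` (cf. `WalkCoordinates.card_zeros_update`, private there). -/
theorem card_zeros_flip {m : ℕ} (x : Fin (m + 1) → Bool) :
    (univ.filter fun j : Fin (m + 1) => Function.update x 0 (!x 0) j = false).card % 2 =
      ((univ.filter fun j : Fin (m + 1) => x j = false).card + 1) % 2 := by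
  have hsplit : ∀ y : Fin (m + 1) → Bool,
      (univ.filter fun j : Fin (m + 1) => y j = false).card =
        ((univ.filter fun j : Fin (m + 1) => y j = false).erase 0).card +
          (if y 0 = false then 1 else 0) := by
    intro y
    by_cases hy : y 0 = false
    · rw [if_pos hy, Finset.card_erase_add_one]
      simpa using hy
    · rw [if_neg hy, add_zero, Finset.erase_eq_of_notMem]
      simpa using hy
  have hrest : ((univ.filter fun j : Fin (m + 1) => Function.update x 0 (!x 0) j = false).erase 0) =
      (univ.filter fun j : Fin (m + 1) => x j = false).erase 0 := by
    ext j
    simp only [mem_erase, mem_filter, mem_univ, true_and]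
    constructor
    · rintro ⟨hj, h⟩; rw [Function.update_of_ne hj] at h; exact ⟨hj, h⟩
    · rintro ⟨hj, h⟩; rw [Function.update_of_ne hj]; exact ⟨hj, h⟩
  rw [hsplit (Function.update x 0 (!x 0)), hrest, hsplit x, Function.update_self]
  cases x 0
  · simp; omega
  · simp

/-- the odd class of `C_n` has at least `2^(n-1)` patterns (`n ≥ 1`). -/
theorem two_pow_le_card_oddClass {n : ℕ} (hn : 1 ≤ n) :
    2 ^ (n - 1) ≤ (univ.filter fun x : Fin n → Bool => OddZeros x).card := by
  obtain ⟨m, rfl⟩ : ∃ m, n = m + 1 := ⟨n - 1, by omega⟩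
  rw [Nat.add_sub_cancel]
  exact Summit.QuantumAdvantage.QuantumAdvantage.Theorems.ExactnessDialOddToAll.two_pow_le_card_odd

/-- the odd class has at most `2^(n-1)` patterns (`n ≥ 1`; flipping bit `0` injects it into the even class). -/
theorem card_oddClass_le {n : ℕ} (hn : 1 ≤ n) :
    (univ.filter fun x : Fin n → Bool => OddZeros x).card ≤ 2 ^ (n - 1) := by
  obtain ⟨m, rfl⟩ : ∃ m, n = m + 1 := ⟨n - 1, by omega⟩
  rw [Nat.add_sub_cancel]
  set O := univ.filter fun x : Fin (m + 1) → Bool => OddZeros x with hO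
  set E := univ.filter fun x : Fin (m + 1) → Bool => ¬ OddZeros x with hE
  have hOE : O.card ≤ E.card := by
    refine Finset.card_le_card_of_injOn (fun x => Function.update x 0 (!x 0)) ?_ ?_
    · intro x hx
      rw [hO, Finset.mem_coe, mem_filter] at hx
      rw [hE, Finset.mem_coe, mem_filter]
      refine ⟨mem_univ _, ?_⟩
      have h1 := card_zeros_flip x
      have h2 := hx.2
      change ¬ OddZeros (Function.update x 0 (!x 0))
      unfold OddZeros at h2 ⊢
      rw [h1]
      omega
    · intro x₁ _ x₂ _ h
      have h' : ∀ x : Fin (m + 1) → Bool,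
          Function.update (Function.update x 0 (!x 0)) 0 (!(Function.update x 0 (!x 0)) 0) = x := by
        intro x
        funext j
        by_cases hj : j = 0
        · subst hj; simp
        · simp [Function.update_of_ne hj]
      have := congrArg (fun x : Fin (m + 1) → Bool => Function.update x 0 (!x 0)) h
      simp only at this
      rwa [h' x₁, h' x₂] at this
  have htot : O.card + E.card = 2 ^ (m + 1) := by
    rw [hO, hE, Finset.card_filter_add_card_filter_not, card_univ, Fintype.card_fun,
      Fintype.card_bool, Fintype.card_fin]
  have : 2 ^ (m + 1) = 2 * 2 ^ m := by ring
  omega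

/-- ScaleDialAA helper `card_oddClass_eq` (decomp-qadv land package; see the module docstring). -/
theorem card_oddClass_eq {n : ℕ} (hn : 1 ≤ n) :
    (univ.filter fun x : Fin n → Bool => OddZeros x).card = 2 ^ (n - 1) :=
  le_antisymm (card_oddClass_le hn) (two_pow_le_card_oddClass hn)

/-- win-count form ⟺ loss-count form. -/
theorem winners_card_eq {n : ℕ} (hn : 1 ≤ n) (P : Fin n → CubeFn (ZMod 3) n) :
    (winners n P).card = 2 ^ (n - 1) - (losers n P).card := by
  have h := losers_card_add_winners_card n P
  rw [card_oddClass_eq hn] at h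
  omega

/-- ScaleDialAA helper `losers_card_le` (decomp-qadv land package; see the module docstring). -/
theorem losers_card_le {n : ℕ} (hn : 1 ≤ n) (P : Fin n → CubeFn (ZMod 3) n) : (losers n P).card ≤ 2 ^ (n - 1) := by
  have h := losers_card_add_winners_card n P
  rw [card_oddClass_eq hn] at h
  omega

/-- `PolyLossOddU3 → QFracU3` (down the ladder: `1/n^C ≥ 1/2^((log₂ n)^(C+1))` for `n ≥ 4`). -/
theorem qFracU3_of_polyLossOddU3 (h : PolyLossOddU3) : QFracU3 := by
  obtain ⟨C, hC⟩ := h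
  refine ⟨C + 1, fun c => ?_⟩
  obtain ⟨n₀, hn₀⟩ := hC c
  refine ⟨max n₀ 4, fun n hn P hP => ?_⟩
  have h1 := hn₀ n (le_trans (le_max_left _ _) hn) P hP
  have hn4 : 4 ≤ n := le_trans (le_max_right _ _) hn
  refine h1.trans (mul_le_mul_of_nonneg_right ?_ (by positivity))
  -- `n^C ≤ 2^((L+1)C) ≤ 2^(L^(C+1))` with `L = log₂ n ≥ 2`
  set L := Nat.log 2 n with hL
  have hL2 : 2 ≤ L := Nat.le_log_of_pow_le (by norm_num) hn4
  have hnlt : n < 2 ^ (L + 1) := Nat.lt_pow_succ_log_self (by norm_num) n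
  have hexp : (L + 1) * C ≤ L ^ (C + 1) := by
    rcases Nat.eq_zero_or_pos C with hC0 | hCpos
    · subst hC0; simp
    · have h2 : L + 1 ≤ L * L := by nlinarith
      have h3 : C ≤ L ^ (C - 1) * 1 := by
        rw [mul_one]
        calc C ≤ 2 ^ (C - 1) := by
              have := Nat.lt_two_pow_self (n := C - 1)
              omega
          _ ≤ L ^ (C - 1) := Nat.pow_le_pow_left hL2 _
      calc (L + 1) * C ≤ (L * L) * L ^ (C - 1) := Nat.mul_le_mul h2 (by simpa using h3)
        _ = L ^ (C - 1 + 2) := by ring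
        _ = L ^ (C + 1) := by congr 1; omega
  have hpow : ((n : ℝ)) ^ C ≤ (2 : ℝ) ^ (L ^ (C + 1)) := by
    have : (n : ℝ) ^ C ≤ ((2 : ℝ) ^ (L + 1)) ^ C := by
      gcongr; exact_mod_cast hnlt.le
    refine this.trans ?_
    rw [← pow_mul]
    exact pow_le_pow_right₀ (by norm_num) hexp
  have hn0 : (0 : ℝ) < n := by exact_mod_cast (show 0 < n by omega)
  have hnpos : (0 : ℝ) < (n : ℝ) ^ C := pow_pos hn0 C
  have : 1 / (2 : ℝ) ^ (L ^ (C + 1)) ≤ 1 / (n : ℝ) ^ C := one_div_le_one_div_of_le hnpos hpow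
  linarith

/-! ### elementary growth bookkeeping: `m^k < 2^m` once `m ≥ 2^(k+1)` -/

/-- ScaleDialAA helper `sq_le_two_pow` (decomp-qadv land package; see the module docstring). -/
theorem sq_le_two_pow (t : ℕ) (ht : 4 ≤ t) : t * t ≤ 2 ^ t := by
  induction t, ht using Nat.le_induction with
  | base => norm_num
  | succ t ht ih =>
    have h1 : 2 * t + 1 ≤ t * t := by nlinarith
    rw [pow_succ]; nlinarith

/-- ScaleDialAA helper `succ_mul_le_two_pow` (decomp-qadv land package; see the module docstring). -/
theorem succ_mul_le_two_pow {l k : ℕ} (h : k + 1 ≤ l) : (l + 1) * k ≤ 2 ^ l := by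
  rcases Nat.lt_or_ge l 4 with h4 | h4
  · interval_cases l <;> norm_num <;> omega
  · obtain ⟨l', rfl⟩ : ∃ l', l = l' + 1 := ⟨l - 1, by omega⟩
    calc (l' + 1 + 1) * k ≤ (l' + 1 + 1) * l' := Nat.mul_le_mul_left _ (by omega)
      _ ≤ (l' + 1) * (l' + 1) := by ring_nf; omega
      _ ≤ 2 ^ (l' + 1) := sq_le_two_pow _ h4

/-- ScaleDialAA helper `pow_lt_two_pow` (decomp-qadv land package; see the module docstring). -/
theorem pow_lt_two_pow {k m : ℕ} (hm : 2 ^ (k + 1) ≤ m) : m ^ k < 2 ^ m := by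
  have hm2 : 2 ≤ m := le_trans (by
    calc 2 = 2 ^ 1 := rfl
      _ ≤ 2 ^ (k + 1) := Nat.pow_le_pow_right (by norm_num) (by omega)) hm
  have hm0 : m ≠ 0 := by omega
  rcases Nat.eq_zero_or_pos k with hk | hk
  · subst hk
    rw [pow_zero]
    exact Nat.one_lt_two_pow hm0
  set l := Nat.log 2 m with hl
  have hml : m < 2 ^ (l + 1) := Nat.lt_pow_succ_log_self (by norm_num) m
  have hlk : k + 1 ≤ l := Nat.le_log_of_pow_le (by norm_num) hm
  have h2l : 2 ^ l ≤ m := Nat.pow_log_le_self 2 hm0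
  calc m ^ k < (2 ^ (l + 1)) ^ k := Nat.pow_lt_pow_left hml (by omega)
    _ = 2 ^ ((l + 1) * k) := by rw [← pow_mul]
    _ ≤ 2 ^ (2 ^ l) := Nat.pow_le_pow_right (by norm_num) (succ_mul_le_two_pow hlk)
    _ ≤ 2 ^ m := Nat.pow_le_pow_right (by norm_num) h2l


end Summit.QuantumAdvantage.QuantumAdvantage.Theorems.ScaleDial
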